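import Literature.Topology.FourManifolds.TubeReadable
import HarnessLib

/-!
# The stage interface, pointwise form

Topic `Literature/Topology/FourManifolds`; companion of `TubeReadable.lean`.  The shell of a simplex
is covered by regions of different nature (original sectors, records of several cofaces), each with
its own first-reading lemma; so the readable-shell predicate is assembled from a POINTWISE predicate
`ShellPointReadable r ρ K₀ C₁ T N q` — the conjunction of the stage hypotheses that mention the
shell point `q`, each guarded by the radius range in which the stage uses it — via
`ShellReadable.of_pointwise`.  Conversely `ShellReadable.pointwise`.  Predicates only; no named
facts.

## References

* J. R. Munkres, *Obstructions to the smoothing of piecewise-differentiable homeomorphisms*, Ann.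
  of Math. (2) 72 (1960), 521–554, §5. [Munkres1960]
-/

noncomputable section

open Set Function Metric Filter
open scoped Topology ContDiff RealInnerProductSpace

namespace Literature.Topology.FourManifolds

variable {E : Type*} [NormedAddCommGroup E] [NormedSpace ℝ E]
variable {F : Type*} [NormedAddCommGroup F] [InnerProductSpace ℝ F]

/-- **Readable shell point.** The stage hypotheses at one point `q` of the shell
`r/4 ≤ ‖q.2‖ ≤ r`, guarded by the radius ranges in which they are used. [folklore] -/
structure ShellPointReadable (r ρ K₀ C₁ : ℝ) (T : E × F → E) (N : E × F → F) (q : E × F) : Prop where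
  /-- `N` is smooth at `q`. -/
  contDiffAt_N : ContDiffAt ℝ ∞ N q
  /-- `T` is smooth at `q` if `q` is in the flatten shell. -/
  contDiffAt_T : 5 * r / 8 ≤ ‖q.2‖ → ContDiffAt ℝ ∞ T q
  /-- At the link level `N q ≠ 0`. -/
  N_ne_zero : ‖q.2‖ = r / 4 → N q ≠ 0
  /-- The fibre derivative of `N` at `q` is injective. -/
  fibre_injective : ∀ w : F, fderiv ℝ N q (0, w) = 0 → w = 0
  /-- Source-form Euler defect bound on the cone shell. -/
  source_defect : ‖q.2‖ ≤ r / 2 →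
    ∀ u : F, fderiv ℝ N q (0, u) = fderiv ℝ N q (0, q.2) - N q → K₀ * ‖u‖ < ‖q.2‖
  /-- Radial transversality at the link level. -/
  transversal : ‖q.2‖ = r / 4 → ∀ v : F, fderiv ℝ N q (0, v) = N q → 0 < ⟪v, q.2⟫
  /-- Round radius bound at the link level: `ρ · (r/4) ≤ ‖N q‖`. -/
  rho_le : ‖q.2‖ = r / 4 → ρ * (r / 4) ≤ ‖N q‖
  /-- Flatten data on the flatten shell. -/
  flatten : 5 * r / 8 ≤ ‖q.2‖ →
    ∃ K δ C D : ℝ, 0 ≤ C ∧ 0 ≤ K ∧ 0 ≤ D ∧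
      (∀ (v : E) (w : F), fderiv ℝ N q (v, w) = 0 → ‖w‖ ≤ K * ‖v‖) ∧
      (∀ v : E, ‖fderiv ℝ T q (v, 0) - v‖ ≤ δ * ‖v‖) ∧
      (∀ w : F, ‖fderiv ℝ T q (0, w)‖ ≤ C * ‖w‖) ∧ ‖T q - q.1‖ ≤ D ∧
      δ + (C + C₁ / r * D) * K < 1

variable {V : Set E} {r ρ K₀ C₁ : ℝ} {T : E × F → E} {N : E × F → F}

omit [NormedAddCommGroup E] [NormedSpace ℝ E] in
/-- The link field at `q` is `(r/4)⁻¹ • N` at the link point, whose fibre coordinate has norm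
`r/4`. [folklore] -/
theorem norm_linkField_eq (hr : 0 < r) (q : E × F) :
    ‖linkField N (r / 4) q‖ = (r / 4)⁻¹ * ‖N (linkPoint (r / 4) q)‖ := by
  rw [linkField, norm_smul, norm_inv, Real.norm_eq_abs, abs_of_pos (by positivity)]
  rfl

/-- **Assembling a readable shell from readable points.** [folklore] -/
theorem ShellReadable.of_pointwise (hr : 0 < r)
    (h : ∀ q : E × F, q.1 ∈ V → r / 4 ≤ ‖q.2‖ → ‖q.2‖ ≤ r → ShellPointReadable r ρ K₀ C₁ T N q) :
    ShellReadable V r ρ K₀ C₁ T N where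
  contDiffAt_N q hq h₁ h₂ := (h q hq h₁ h₂).contDiffAt_N
  contDiffAt_T q hq h₁ h₂ := (h q hq (by linarith) h₂).contDiffAt_T h₁
  N_ne_zero q hq h₁ := (h q hq h₁.ge (by rw [h₁]; linarith)).N_ne_zero h₁
  fibre_injective q hq h₁ h₂ := (h q hq h₁ h₂).fibre_injective
  source_defect q hq h₁ h₂ := (h q hq h₁ (by linarith)).source_defect h₂
  transversal q hq h₁ := (h q hq h₁.ge (by rw [h₁]; linarith)).transversal h₁
  rho_le q hq hq0 := by
    -- reduce to the link point, where `‖·.2‖ = r/4`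
    have hn : ‖(linkPoint (r / 4) q).2‖ = r / 4 := norm_linkPoint_snd hq0 (by positivity)
    have hP := h (linkPoint (r / 4) q) hq hn.ge (by rw [hn]; linarith)
    have h1 := hP.rho_le hn
    rw [norm_linkField_eq hr, le_inv_mul_iff₀ (by positivity : (0 : ℝ) < r / 4)]
    linarith
  flatten q hq h₁ h₂ := (h q hq (by linarith) h₂).flatten h₁

/-- **Conversely**, a readable shell is readable at each shell point. [folklore] -/
theorem ShellReadable.pointwise (hr : 0 < r) (hS : ShellReadable V r ρ K₀ C₁ T N) {q : E × F} (hq : q.1 ∈ V)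
    (h₁ : r / 4 ≤ ‖q.2‖) (h₂ : ‖q.2‖ ≤ r) : ShellPointReadable r ρ K₀ C₁ T N q where
  contDiffAt_N := hS.contDiffAt_N q hq h₁ h₂
  contDiffAt_T h := hS.contDiffAt_T q hq h h₂
  N_ne_zero h := hS.N_ne_zero q hq h
  fibre_injective := hS.fibre_injective q hq h₁ h₂
  source_defect h := hS.source_defect q hq h₁ h
  transversal h := hS.transversal q hq h
  rho_le h := by
    have hq0 : q.2 ≠ 0 := by
      intro h0; rw [h0, norm_zero] at h; linarith
    have h1 := hS.rho_le q hq hq0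
    rw [norm_linkField_eq hr, le_inv_mul_iff₀ (by positivity : (0 : ℝ) < r / 4)] at h1
    -- the link point of `q` is `q` itself when `‖q.2‖ = r/4`
    have hlp : linkPoint (r / 4) q = q := by
      obtain ⟨x, y⟩ := q
      simp only [linkPoint] at h ⊢
      rw [h, div_self (by positivity : (r / 4 : ℝ) ≠ 0), one_smul]
    rw [hlp] at h1
    linarith
  flatten h := hS.flatten q hq h h₂

end Literature.Topology.FourManifolds
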